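import Literature.MathematicalPhysics.QuantumFieldTheory.Balaban1983to89.B15Prop1SliceHessianOfChartFamily
import Literature.MathematicalPhysics.QuantumFieldTheory.Balaban1983to89.B15Prop1ValueOfAnyMinimiserB

/-!
# `Balaban1983to89.B15Prop1SliceHessianOfChartFamilyB` — [Balaban1989LargeFieldI] (= [B15]) (1.74) p. 192, (1.77) p. 194; [Balaban1989LargeFieldII] p. 359; [Balaban1988Convergent] (2.12) p. 256;
# [Balaban1984PropagatorsII] (= [II]) (2.3) p. 224: PRINT'S VALUE IDENTITY ALONG THE SLICE AT THE **BOND-LEVEL** (2.12) DATA OF RECORD — the print-datum edition of the one datum-bearing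
# declaration of `B15Prop1SliceHessianOfChartFamily` that N12's junction of record uses (`eventually_sliceFn_fun177std_bgMSCoPOfRecord_eq_wilsonAction4`) (THEOREMS ONLY)

statement-level skeleton of published theorems with citation tags; proofs where landed; nothing here is a claim about
the Yang–Mills mass gap

Cell `pub-ymgap` (HUMAN RULINGS D-0062 ∕ D-0149), lane `pub-ymgap-dag-n12-c` g35 (R134 seat (a), N12 = [B15], s1); `--kind proof --supports` K1⁹ `stmt-QuantumFields-27364`;
count-neutral.  THEOREMS ONLY (0 `def`, 0 `instance`, 0 `sorry`).  (E1) variant (iii-b), class (β) of the lane's census-by-declaration (bus [DAGN12C-G35]).  The parent's §2–§3 (the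
second-order chain rule, the Hessian pairing, `h17Shape_of_hessian_chartFamily_ge_sub`) are datum-FREE in their statements and are consumed as they stand.

HONESTY GUARD (director-ym №338 (5)).  PURELY ADDITIVE: the (b)-keyed parent stays landed and true on its own text; the proof is the parent's one-liner over the lane's
`fun177stdB_bgOfRecordB_eq_wilsonAction4_of_isMinimizerB ∕ …bgMSCoPOfRecordB…`.  No displayed premise of any consumer is deleted or weakened.

WHAT IS HERE.  ★ `eventually_sliceFn_fun177stdB_bgOfRecordB_eq_wilsonAction4` (any class `reg`, any bond-datum family `bd`) · ★ `eventually_sliceFn_fun177stdB_bgMSCoPOfRecordB_eq_wilsonAction4`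
(the bond-level data of record, S2b).

HONEST SCOPE.  Bookkeeping; nothing of [15] asserted; count-neutral; N12 NOT discharged; K0⁷ ∕ K1⁹ NOT closed; one finite 𝕋⁴ programme at fixed ε — nothing continuum ∕ ℝ⁴ ∕ OS; the
Yang–Mills mass gap (Clay) is NOT proved by any of this.

References: [B15] = [Balaban1989LargeFieldI] (1.74) p.192, (1.77) p.194; [Balaban1989LargeFieldII] (1.12) p.359; [III] = [Balaban1988Convergent] (2.12) p.256; [II] = [Balaban1984PropagatorsII] (2.3)
p.224; [15] = [Balaban1985Variational] (2) p.278, Prop. 9 (190) p.309.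
-/

noncomputable section

open Set Metric Filter
open scoped InnerProductSpace Topology BigOperators

namespace Literature.MathematicalPhysics.QuantumFieldTheory.Balaban1983to89.B15Prop1SliceHessianOfChartFamily

open B15Prop1SliceCoordinates (GaugeSlice ιA)
open B15Prop1SliceTaylorCalculus (rGrad rieszR inner_rGrad inner_rieszR sliceFn sliceFn_apply)
open B15Prop1ChartCalculusSU2 (E3)
open B15Prop1ChartSU2 (su2Chart)
open T4CubeChartGnomonic (SU2)
open T4Continuum B15DeterminingSets B15DeterminingSetsB GaugeField
open Node00
open B16Sect1Backgrounds (expMul)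
open B15Eq177ValueInvariance B15Sect1Instances B14.Eq213DetSet B14.Eq216Concrete
open B15Prop1ValueOfAnyMinimiser (fun177stdB_bgOfRecordB_eq_wilsonAction4_of_isMinimizerB fun177stdB_bgMSCoPOfRecordB_eq_wilsonAction4_of_isMinimizerB)
open Literature.MathematicalPhysics.QuantumFieldTheory.BalabanImbrieJaffe1984to88.BIJ85Eq453GaugeField (qsstarGIter0)

variable {P : Params} {k : ℕ} [DecidableEq (PBond P k)] (S : Set (Site P k)) (T : Finset (PBond P k))

/-- ★ **(j2) at the totalised BOND-LEVEL solution map** `Node00.bgOfRecordB av reg` (any class `reg`, any bond-datum family `bd`): a family `U Y` of minimisers of the data along the slice near `0`,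
constrained on the bonds `bd k {Ω_j(Z)}` ⇒ `sliceFn S T (fun177stdB (bgOfRecordB av reg) M₁ bd Z k) Ṽ_k Y = A(U Y)` near `0`; twin of the parent's generic-class step.
[cite: Balaban1989LargeFieldI, (1.74) p.192, (1.77) p.194; Balaban1989LargeFieldII, p.359; Balaban1988Convergent, (2.12) p.256; Balaban1984PropagatorsII, (2.3) p.224] -/
theorem eventually_sliceFn_fun177stdB_bgOfRecordB_eq_wilsonAction4 [MeasurableSpace SU2] (av : ∀ j, Averaging P j SU2) (reg : Set (GaugeField P 0 SU2))
    (M₁ : ℕ) (bd : ℕ → (ℕ → Set (Site P 0)) → BDetSet P) (Z : Set (Site P 0)) (V : GaugeField P k SU2) {U : GaugeSlice S T E3 → GaugeField P 0 SU2}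
    (hmin : ∀ᶠ Y in 𝓝 (0 : GaugeSlice S T E3),
      IsMinimizerB av reg (bd k (maxDomT M₁ Z)) (avgFamily av (qsstarGIter0 k (expMul su2Chart (ιA S T Y) V))) (U Y)) :
    ∀ᶠ Y in 𝓝 (0 : GaugeSlice S T E3), sliceFn S T (fun177stdB (bgOfRecordB av reg) M₁ bd Z k) V Y = wilsonAction4 (U Y) :=
  hmin.mono fun Y hY => by
    rw [sliceFn_apply]
    exact fun177stdB_bgOfRecordB_eq_wilsonAction4_of_isMinimizerB av reg M₁ bd Z k hY

/-- ★ **(j2) AT THE BOND-LEVEL (2.12) DATA OF RECORD** (`Node00.bgMSCoPOfRecordB F 2 ν Kt k′ Ω`, S2b; the class `regMSCoPOfRecord F 2 ν Kt k′ Ω` = [15] (2), print's, unchanged): a family `U Y` of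
minimisers along the slice near `0`, constrained on the bonds `bd k {Ω_j(Z)}` ⇒ `sliceFn S T (fun177stdB (bgMSCoPOfRecordB F 2 ν Kt k′ Ω) M₁ bd Z k) Ṽ_k Y = A(U Y)` near `0`; twin of
`eventually_sliceFn_fun177std_bgMSCoPOfRecord_eq_wilsonAction4`. [cite: Balaban1989LargeFieldI, (1.74) p.192, (1.77) p.194; Balaban1989LargeFieldII, p.359; Balaban1988Convergent, (2.12) p.256; Balaban1985Variational, (2) p.278, Prop. 9 (190) p.309; Balaban1984PropagatorsII, (2.3) p.224] -/
theorem eventually_sliceFn_fun177stdB_bgMSCoPOfRecordB_eq_wilsonAction4 {F : T4Family} (ν : Stage7Numerics) (Kt k' : ℕ) (Ω : ℕ → Set (Site (F.P Kt) 0))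
    (M₁ : ℕ) (bd : ℕ → (ℕ → Set (Site (F.P Kt) 0)) → BDetSet (F.P Kt)) (Z : Set (Site (F.P Kt) 0)) {k : ℕ} [DecidableEq (PBond (F.P Kt) k)]
    (S : Set (Site (F.P Kt) k)) (T : Finset (PBond (F.P Kt) k))
    (V : GaugeField (F.P Kt) k SU2) {U : GaugeSlice S T E3 → GaugeField (F.P Kt) 0 SU2}
    (hmin : ∀ᶠ Y in 𝓝 (0 : GaugeSlice S T E3),
      IsMinimizerB (avOfRecord F 2 Kt) (regMSCoPOfRecord F 2 ν Kt k' Ω) (bd k (maxDomT M₁ Z))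
        (avgFamily (avOfRecord F 2 Kt) (qsstarGIter0 k (expMul su2Chart (ιA S T Y) V))) (U Y)) :
    ∀ᶠ Y in 𝓝 (0 : GaugeSlice S T E3), sliceFn S T (fun177stdB (bgMSCoPOfRecordB F 2 ν Kt k' Ω) M₁ bd Z k) V Y = wilsonAction4 (U Y) :=
  hmin.mono fun Y hY => by
    rw [sliceFn_apply]
    exact fun177stdB_bgMSCoPOfRecordB_eq_wilsonAction4_of_isMinimizerB (N := 2) ν Kt k' Ω M₁ bd Z k hY

end Literature.MathematicalPhysics.QuantumFieldTheory.Balaban1983to89.B15Prop1SliceHessianOfChartFamily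

end
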